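import Summits.BirchSwinnertonDyer.BirchSwinnertonDyer.Theorems.AdditiveKolyvaginRoadLevelSystemsCanonicalUpperLevels
import HarnessLib

/-!
# Route `AdditiveKolyvaginRoad`, crux `LevelKolyvaginSystemsAdditive` (item stmt-BirchSwinnertonDyer-21396, KS′):
# CANONICAL LINES, part 2 — the carrier's upper-level fields from the TWIN DICHOTOMY, ČEBOTAREV in the conductor direction
# and the bottom parity ALONE (no level-direction input above conductor `∅`) — abstract
# (cell `pub/bsd-wall`, width seat `bsd-wall-akr-p2x-w2` g6; `--supports stmt-BirchSwinnertonDyer-21396`, helper; after part 1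
# `…LevelSystemsCanonicalUpperLevels`)

WHY. Part 1 (`CoreGraph.exists_canonicalUpperLevels`) inhabits the upper-level fields of the carrier `LevelKolyvaginSystemP` by
canonical lines, using for the `transport` field the level-direction inputs (Inert) ∕ (Lower) ∕ «in» at EVERY conductor `m` — E-side,
for the mixed spaces `Sel(m, n)` (Kummer off `m ∪ n`, toric on `n`, transverse on `m`), those are ports of the tree's `SelQP` lemmas with
transverse places added. THIS FILE removes them: `transport` follows from the twin dichotomy, ČEBOTAREV in the CONDUCTOR direction
(McCallum 1991 Cor. 3.2 for eigenclasses — a tree THEOREM at every odd `p` with `ρ̄` onto, `chebOne_of_mcCallum_P` ∕ `chebTwo_of_mcCallum_P`)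
and the parity of the total rank at conductor `∅` (tree `odd_total_iff_even_card` for `SelQP` + `dim Sel_p(E/K)` odd). So the E-side
obligations of «KS′(frame) ⟸ seed» shrink to: finite-dimensionality of the mixed spaces, (Twin) = Howard 2004 Lemma 2.5.3 for them,
McCallum's Čebotarev, and the bottom parity.

WHAT. §1 `exists_canonicalUpperLevels_core` — the canonical classes with membership ∕ `sign`, RELATION (8.1) and «non-zero EXACTLY at
the cores», from (Twin) alone. §2 `exists_core_conductor_superset` — above every conductor of odd total rank, at a non-empty level, there
is a CORE conductor (Howard 2004 Lemma 2.6.4's case analysis: (Cheb2) lowers both signs, (Cheb1) + the jump turns `(r, 0)` into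
`(r − 1, 1)`; `max(r⁺, r⁻)` drops). §3 `exists_canonicalUpperLevels_of_cheb` — THE RESULT in Čebotarev form (conclusion verbatim that of
part 1).

HONEST FRAMING: pure linear algebra + combinatorics; 0 definitions, 0 named facts, 0 `sorry`; (Twin) ∕ (Cheb1) ∕ (Cheb2) ∕ parity are
HYPOTHESES; closes nothing. It says nothing about level `∅` and nothing about which frames carry a seed. BSD is not proved by any of this;
KS′ is not proved by this.

References: [cite: Howard2004HeegnerKolyvagin, Lemma 2.5.3, Lemma 2.6.2, Lemma 2.6.4] [cite: McCallumLMS1991, Cor. 3.2]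
[cite: WZhang2014, Thm. 4.3, Thm. 7.2, §8.1 (8.1)] [cite: Howard2006Bipartite, Lemma 2.4.9].
-/

noncomputable section

open scoped Classical

namespace Summit.BirchSwinnertonDyer.Rank1Residual.X11b.Three.Koly.CoreGraph

open Module

variable {F : Type*} [Field F] {H : Type*} [AddCommGroup H] [Module F H] {M Q : Type*} [DecidableEq M] [DecidableEq Q]
  (Sel : Finset M → Finset Q → Bool → Submodule F H) (TM : M → H → Prop) (TQ : Q → H → Prop)

/-! ## §1 The canonical classes: membership ∕ sign, relation (8.1), non-vanishing exactly at the cores -/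

omit [DecidableEq Q] in
/-- **CANONICAL LINES, core form** (no level-direction input at all): from finite-dimensionality, the scalar-closure of «locally
trivial above `ℓ`», and Howard's twin dichotomy (`hDrop`, `hRise`, `hJump`) at every NON-EMPTY level, there are level signs `ε₀` and
classes `κ m n` with: membership `κ m n ∈ Sel(m, n)^{ε₀ n xor bodd #m}` at non-empty levels (the carrier's `sign` pattern), RELATION
(8.1) two-sided across every Kolyvagin step at non-empty levels, `κ m n ≠ 0` EXACTLY at the cores (total rank one). The transport
field is derived from this in two ways: `exists_canonicalUpperLevels` (part 1: (Inert)/(Lower) in the level direction at every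
conductor) and `exists_canonicalUpperLevels_of_cheb` below (Čebotarev in the conductor direction).
[cite: Howard2004HeegnerKolyvagin, Lemma 2.5.3] [cite: WZhang2014, §8.1 (8.1), Thm. 7.2] -/
theorem exists_canonicalUpperLevels_core
    (hfin : ∀ (m : Finset M) (n : Finset Q) (μ : Bool), Module.Finite F (Sel m n μ))
    (hTM0 : ∀ ℓ, TM ℓ 0) (hTMsmul : ∀ (ℓ : M) (c : F) (x : H), TM ℓ x → TM ℓ (c • x))
    (hDrop : ∀ (m : Finset M) (ℓ : M) (n : Finset Q) (μ : Bool), ℓ ∉ m → n.Nonempty → (∃ x ∈ Sel m n μ, ¬ TM ℓ x) →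
      (∀ y, y ∈ Sel (insert ℓ m) n μ ↔ (y ∈ Sel m n μ ∧ TM ℓ y)) ∧
        finrank F (Sel (insert ℓ m) n μ) + 1 = finrank F (Sel m n μ))
    (hRise : ∀ (m : Finset M) (ℓ : M) (n : Finset Q) (μ : Bool), ℓ ∉ m → n.Nonempty →
      (∃ y ∈ Sel (insert ℓ m) n μ, ¬ TM ℓ y) →
      (∀ x, x ∈ Sel m n μ ↔ (x ∈ Sel (insert ℓ m) n μ ∧ TM ℓ x)) ∧
        finrank F (Sel m n μ) + 1 = finrank F (Sel (insert ℓ m) n μ))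
    (hJump : ∀ (m : Finset M) (ℓ : M) (n : Finset Q) (μ : Bool), ℓ ∉ m → n.Nonempty →
      (∃ x ∈ Sel m n μ, ¬ TM ℓ x) ∨ (∃ y ∈ Sel (insert ℓ m) n μ, ¬ TM ℓ y)) :
    ∃ (ε₀ : Finset Q → Bool) (κ : Finset M → Finset Q → H),
      (∀ n : Finset Q, n.Nonempty → ∀ m : Finset M, κ m n ∈ Sel m n (ε₀ n ^^ m.card.bodd)) ∧
      (∀ n : Finset Q, n.Nonempty → ∀ (m : Finset M) (ℓ : M), ℓ ∉ m →
        (TM ℓ (κ (insert ℓ m) n) ↔ TM ℓ (κ m n))) ∧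
      (∀ (n : Finset Q) (m : Finset M), finrank F (Sel m n true) + finrank F (Sel m n false) = 1 → κ m n ≠ 0) ∧
      (∀ (n : Finset Q) (m : Finset M), finrank F (Sel m n true) + finrank F (Sel m n false) ≠ 1 → κ m n = 0) := by
  -- the canonical choice: a generator at the cores, `0` elsewhere
  have key : ∀ (m : Finset M) (n : Finset Q), ∃ (x : H) (μ : Bool),
      (finrank F (Sel m n true) + finrank F (Sel m n false) = 1 →
        finrank F (Sel m n μ) = 1 ∧ Sel m n (!μ) = ⊥ ∧ x ∈ Sel m n μ ∧ x ≠ 0 ∧ ∀ y ∈ Sel m n μ, ∃ c : F, c • x = y) ∧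
      (finrank F (Sel m n true) + finrank F (Sel m n false) ≠ 1 → x = 0) := by
    intro m n
    by_cases h1 : finrank F (Sel m n true) + finrank F (Sel m n false) = 1
    · obtain ⟨μ, s, h⟩ := exists_generator_of_total_eq_one (Sel m) (hfin m) h1
      exact ⟨s, μ, fun _ ↦ h, fun h ↦ absurd h1 h⟩
    · exact ⟨0, true, fun h ↦ absurd h h1, fun _ ↦ rfl⟩
  choose κ μ₀ hcore hzero using key
  refine ⟨fun n ↦ (finrank F (Sel ∅ n true)).bodd, κ, ?_, ?_, fun n m h1 ↦ (hcore m n h1).2.2.2.1,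
    fun n m h ↦ hzero m n h⟩
  · -- `sign` ∕ membership: the parity bookkeeping of part 1 §2 pins the core sign
    intro n hn m
    by_cases h1 : finrank F (Sel m n true) + finrank F (Sel m n false) = 1
    · obtain ⟨hμ1, hnot, hmem, -, -⟩ := hcore m n h1
      have hpt := bodd_finrank_eq Sel TM n (fun m ℓ μ hℓ ↦ hDrop m ℓ n μ hℓ hn) (fun m ℓ μ hℓ ↦ hRise m ℓ n μ hℓ hn)
        (fun m ℓ μ hℓ ↦ hJump m ℓ n μ hℓ hn) m true
      have hsign : μ₀ m n = ((finrank F (Sel ∅ n true)).bodd ^^ m.card.bodd) := by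
        revert hpt
        cases hμ : μ₀ m n
        · have ht : finrank F (Sel m n true) = 0 := by
            have := hnot; rw [hμ] at this; change Sel m n true = ⊥ at this; rw [this, finrank_bot]
          rw [ht]
          cases (finrank F (Sel ∅ n true)).bodd <;> cases m.card.bodd <;> decide
        · have ht : finrank F (Sel m n true) = 1 := by rw [hμ] at hμ1; exact hμ1
          rw [ht]
          cases (finrank F (Sel ∅ n true)).bodd <;> cases m.card.bodd <;> decide
      rw [← hsign]
      exact hmem
    · rw [hzero m n h1]
      exact Submodule.zero_mem _
  · -- `relation` (8.1), both directions
    intro n hn m ℓ hℓ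
    constructor
    · intro h
      by_contra hc
      exact (not_triv_of_not_triv_canonical (A := Sel m n) (B := Sel (insert ℓ m) n) (hTM0 ℓ) (hTMsmul ℓ)
        (fun μ ↦ hDrop m ℓ n μ hℓ hn) (fun μ ↦ hRise m ℓ n μ hℓ hn) (fun μ ↦ hJump m ℓ n μ hℓ hn)
        (hcore m n) (hzero m n) (hcore (insert ℓ m) n) hc) h
    · intro h
      by_contra hc
      exact (not_triv_of_not_triv_canonical (A := Sel (insert ℓ m) n) (B := Sel m n) (hTM0 ℓ) (hTMsmul ℓ)
        (fun μ h' ↦ hRise m ℓ n μ hℓ hn h') (fun μ h' ↦ hDrop m ℓ n μ hℓ hn h')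
        (fun μ ↦ (hJump m ℓ n μ hℓ hn).symm) (hcore (insert ℓ m) n) (hzero (insert ℓ m) n) (hcore m n) hc) h

/-! ## §2 Cores above a conductor, by Čebotarev in the conductor direction (Howard 2004 Lemma 2.6.4, case analysis) -/

omit [DecidableEq Q] in
/-- **Above every conductor of odd total rank there is a CORE conductor** at a fixed non-empty level (the conductor-direction
analogue of Howard 2006 Lemma 2.4.9, by the case analysis of Howard 2004 Lemma 2.6.4): if both signed ranks are non-zero, a Kolyvagin
prime detecting a class of each sign lowers both ((Cheb2), McCallum Cor. 3.2); if one signed rank is zero and the other is `≥ 2`, a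
prime detecting the non-zero side lowers it by one and raises the zero side to one ((Cheb1) + the jump); in both cases `max(r⁺, r⁻)`
drops, and at `max ≤ 1` an odd total rank is `1`. [cite: Howard2004HeegnerKolyvagin, Lemma 2.5.3, Lemma 2.6.2, Lemma 2.6.4]
[cite: McCallumLMS1991, Cor. 3.2] -/
theorem exists_core_conductor_superset (n : Finset Q) (hn : n.Nonempty)
    (hfin : ∀ (m : Finset M) (n : Finset Q) (μ : Bool), Module.Finite F (Sel m n μ)) (hTM0 : ∀ ℓ, TM ℓ 0)
    (hDrop : ∀ (m : Finset M) (ℓ : M) (n : Finset Q) (μ : Bool), ℓ ∉ m → n.Nonempty → (∃ x ∈ Sel m n μ, ¬ TM ℓ x) →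
      (∀ y, y ∈ Sel (insert ℓ m) n μ ↔ (y ∈ Sel m n μ ∧ TM ℓ y)) ∧
        finrank F (Sel (insert ℓ m) n μ) + 1 = finrank F (Sel m n μ))
    (hRise : ∀ (m : Finset M) (ℓ : M) (n : Finset Q) (μ : Bool), ℓ ∉ m → n.Nonempty →
      (∃ y ∈ Sel (insert ℓ m) n μ, ¬ TM ℓ y) →
      (∀ x, x ∈ Sel m n μ ↔ (x ∈ Sel (insert ℓ m) n μ ∧ TM ℓ x)) ∧
        finrank F (Sel m n μ) + 1 = finrank F (Sel (insert ℓ m) n μ))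
    (hJump : ∀ (m : Finset M) (ℓ : M) (n : Finset Q) (μ : Bool), ℓ ∉ m → n.Nonempty →
      (∃ x ∈ Sel m n μ, ¬ TM ℓ x) ∨ (∃ y ∈ Sel (insert ℓ m) n μ, ¬ TM ℓ y))
    (hCheb1 : ∀ (B m : Finset M) (n : Finset Q) (μ : Bool) (x : H), n.Nonempty → x ∈ Sel m n μ → x ≠ 0 →
      ∃ ℓ, ℓ ∉ B ∧ ¬ TM ℓ x)
    (hCheb2 : ∀ (B m : Finset M) (n : Finset Q) (x y : H), n.Nonempty → x ∈ Sel m n true → x ≠ 0 →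
      y ∈ Sel m n false → y ≠ 0 → ∃ ℓ, ℓ ∉ B ∧ ¬ TM ℓ x ∧ ¬ TM ℓ y)
    (m : Finset M) (hodd : Odd (finrank F (Sel m n true) + finrank F (Sel m n false))) :
    ∃ m' : Finset M, m ⊆ m' ∧ finrank F (Sel m' n true) + finrank F (Sel m' n false) = 1 := by
  -- induction on `max (r⁺, r⁻)`
  suffices H : ∀ (k : ℕ) (m : Finset M), max (finrank F (Sel m n true)) (finrank F (Sel m n false)) = k →
      Odd (finrank F (Sel m n true) + finrank F (Sel m n false)) →
      ∃ m' : Finset M, m ⊆ m' ∧ finrank F (Sel m' n true) + finrank F (Sel m' n false) = 1 from H _ m rfl hodd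
  intro k
  induction k using Nat.strong_induction_on with
  | _ k ih =>
    intro m hk hodd
    -- parity along the conductor: the total rank parity is the same at every conductor
    by_cases hk1 : k ≤ 1
    · -- `max ≤ 1` and odd total: the total is `1`
      refine ⟨m, Finset.Subset.refl m, ?_⟩
      have ht : finrank F (Sel m n true) ≤ 1 := (le_max_left _ _).trans (hk ▸ hk1)
      have hf : finrank F (Sel m n false) ≤ 1 := (le_max_right _ _).trans (hk ▸ hk1)
      obtain ⟨r, hr⟩ := hodd
      omega
    · by_cases hboth : 0 < finrank F (Sel m n true) ∧ 0 < finrank F (Sel m n false)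
      · -- both signs non-zero: a prime detecting a class of each sign lowers both ranks
        obtain ⟨x, hx, hx0⟩ := exists_mem_ne_zero_of_finrank_pos' hboth.1
        obtain ⟨y, hy, hy0⟩ := exists_mem_ne_zero_of_finrank_pos' hboth.2
        obtain ⟨ℓ, hℓm, hℓx, hℓy⟩ := hCheb2 m m n x y hn hx hx0 hy hy0
        have ht := (hDrop m ℓ n true hℓm hn ⟨x, hx, hℓx⟩).2
        have hf := (hDrop m ℓ n false hℓm hn ⟨y, hy, hℓy⟩).2
        obtain ⟨m', hmm', hm'⟩ := ih (k - 1) (by omega) (insert ℓ m) (by rw [← hk]; omega)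
          (by obtain ⟨r, hr⟩ := hodd; exact ⟨r - 1, by omega⟩)
        exact ⟨m', (Finset.subset_insert ℓ m).trans hmm', hm'⟩
      · -- one sign is zero, the other is `≥ 2`: detect the non-zero side; the zero side rises to one
        obtain ⟨μ, hμpos, hμ0⟩ : ∃ μ : Bool, 2 ≤ finrank F (Sel m n μ) ∧ finrank F (Sel m n (!μ)) = 0 := by
          rcases Nat.eq_zero_or_pos (finrank F (Sel m n true)) with ht | ht
          · refine ⟨false, ?_, ht⟩
            have : max (finrank F (Sel m n true)) (finrank F (Sel m n false)) = finrank F (Sel m n false) := by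
              rw [ht, Nat.zero_max]
            omega
          · rcases Nat.eq_zero_or_pos (finrank F (Sel m n false)) with hf | hf
            · refine ⟨true, ?_, hf⟩
              have : max (finrank F (Sel m n true)) (finrank F (Sel m n false)) = finrank F (Sel m n true) := by
                rw [hf, Nat.max_zero]
              change 2 ≤ finrank F (Sel m n true)
              omega
            · exact absurd ⟨ht, hf⟩ hboth
        obtain ⟨x, hx, hx0⟩ := exists_mem_ne_zero_of_finrank_pos' (show 0 < finrank F (Sel m n μ) by omega)
        obtain ⟨ℓ, hℓm, hℓx⟩ := hCheb1 m m n μ x hn hx hx0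
        have hdropμ := (hDrop m ℓ n μ hℓm hn ⟨x, hx, hℓx⟩).2
        -- the zero side has no detected class, so the jump is upstairs and the rank rises to `1`
        haveI := hfin m n (!μ)
        have hbot : Sel m n (!μ) = ⊥ := Submodule.finrank_eq_zero.mp hμ0
        have hno : ¬ ∃ x ∈ Sel m n (!μ), ¬ TM ℓ x := by
          rintro ⟨z, hz, hTz⟩
          rw [hbot, Submodule.mem_bot] at hz
          exact hTz (hz ▸ hTM0 ℓ)
        have hriseμ := (hRise m ℓ n (!μ) hℓm hn ((hJump m ℓ n (!μ) hℓm hn).resolve_left hno)).2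
        rw [hμ0] at hriseμ
        -- the new conductor has signed ranks `(r − 1, 1)`: `max` drops, total parity kept
        have hnew : finrank F (Sel (insert ℓ m) n true) + finrank F (Sel (insert ℓ m) n false) =
            finrank F (Sel m n true) + finrank F (Sel m n false) ∧
            max (finrank F (Sel (insert ℓ m) n true)) (finrank F (Sel (insert ℓ m) n false)) = k - 1 := by
          revert hdropμ hriseμ hμ0 hμpos hk
          cases μ
          · rw [Bool.not_false]
            intro h1 h2 h3 h4 h5
            omega
          · rw [Bool.not_true]
            intro h1 h2 h3 h4 h5
            omega
        obtain ⟨hnew_t, hnew_max⟩ := hnew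
        obtain ⟨m', hmm', hm'⟩ := ih (k - 1) (by omega) (insert ℓ m) hnew_max (by rw [hnew_t]; exact hodd)
        exact ⟨m', (Finset.subset_insert ℓ m).trans hmm', hm'⟩

/-! ## §3 The carrier's upper-level fields from the twin dichotomy, Čebotarev and the bottom parity alone -/

/-- **CANONICAL LINES inhabit the carrier's upper-level fields — Čebotarev form.** Same conclusion as part 1's
`exists_canonicalUpperLevels` (membership ∕ `sign`, RELATION (8.1), TRANSPORT, BASE CASE, vanishing off the cores), but the
level-direction inputs (Inert) ∕ (Lower) ∕ «in» at every conductor are REPLACED by Čebotarev in the conductor direction at the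
non-empty levels ((Cheb1): a non-zero class of `Sel(m, n)^μ` is detected above a Kolyvagin prime outside any finite set; (Cheb2): a
non-zero class of each sign simultaneously — McCallum 1991 Cor. 3.2, tree `chebOne_of_mcCallum_P` ∕ `chebTwo_of_mcCallum_P`) and the
PARITY of the total rank at conductor `∅` (odd ⟺ even level). TRANSPORT then reads: a class two admissible primes up is detected ⟹ that
level has a core ⟹ (parity along the conductor, part 1 §2, and at conductor `∅`) the bottom level `n` is even ⟹ `Sel(∅, n)` has odd total
rank ⟹ a CORE conductor lies above `∅` at level `n` (§2) ⟹ its canonical class is non-zero. E-side this leaves: finite-dimensionality,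
(Twin) for the mixed spaces, McCallum's Čebotarev, and `dim Sel_p(E/K)` odd with the level-direction parity of the canonical spaces
(tree `odd_total_iff_even_card` for `SelQP`). [cite: Howard2004HeegnerKolyvagin, Lemma 2.5.3, Lemma 2.6.4]
[cite: McCallumLMS1991, Cor. 3.2] [cite: WZhang2014, Thm. 4.3, Thm. 7.2, §8.1 (8.1)] -/
theorem exists_canonicalUpperLevels_of_cheb
    (hfin : ∀ (m : Finset M) (n : Finset Q) (μ : Bool), Module.Finite F (Sel m n μ))
    (hTM0 : ∀ ℓ, TM ℓ 0) (hTMsmul : ∀ (ℓ : M) (c : F) (x : H), TM ℓ x → TM ℓ (c • x)) (hTQ0 : ∀ q, TQ q 0)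
    (hDrop : ∀ (m : Finset M) (ℓ : M) (n : Finset Q) (μ : Bool), ℓ ∉ m → n.Nonempty → (∃ x ∈ Sel m n μ, ¬ TM ℓ x) →
      (∀ y, y ∈ Sel (insert ℓ m) n μ ↔ (y ∈ Sel m n μ ∧ TM ℓ y)) ∧
        finrank F (Sel (insert ℓ m) n μ) + 1 = finrank F (Sel m n μ))
    (hRise : ∀ (m : Finset M) (ℓ : M) (n : Finset Q) (μ : Bool), ℓ ∉ m → n.Nonempty →
      (∃ y ∈ Sel (insert ℓ m) n μ, ¬ TM ℓ y) →
      (∀ x, x ∈ Sel m n μ ↔ (x ∈ Sel (insert ℓ m) n μ ∧ TM ℓ x)) ∧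
        finrank F (Sel m n μ) + 1 = finrank F (Sel (insert ℓ m) n μ))
    (hJump : ∀ (m : Finset M) (ℓ : M) (n : Finset Q) (μ : Bool), ℓ ∉ m → n.Nonempty →
      (∃ x ∈ Sel m n μ, ¬ TM ℓ x) ∨ (∃ y ∈ Sel (insert ℓ m) n μ, ¬ TM ℓ y))
    (hCheb1 : ∀ (B m : Finset M) (n : Finset Q) (μ : Bool) (x : H), n.Nonempty → x ∈ Sel m n μ → x ≠ 0 →
      ∃ ℓ, ℓ ∉ B ∧ ¬ TM ℓ x)
    (hCheb2 : ∀ (B m : Finset M) (n : Finset Q) (x y : H), n.Nonempty → x ∈ Sel m n true → x ≠ 0 →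
      y ∈ Sel m n false → y ≠ 0 → ∃ ℓ, ℓ ∉ B ∧ ¬ TM ℓ x ∧ ¬ TM ℓ y)
    (hpar : ∀ n : Finset Q, n.Nonempty →
      (Odd (finrank F (Sel ∅ n true) + finrank F (Sel ∅ n false)) ↔ Even n.card)) :
    ∃ (ε₀ : Finset Q → Bool) (κ : Finset M → Finset Q → H),
      (∀ n : Finset Q, n.Nonempty → ∀ m : Finset M, κ m n ∈ Sel m n (ε₀ n ^^ m.card.bodd)) ∧
      (∀ n : Finset Q, n.Nonempty → ∀ (m : Finset M) (ℓ : M), ℓ ∉ m →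
        (TM ℓ (κ (insert ℓ m) n) ↔ TM ℓ (κ m n))) ∧
      (∀ (n : Finset Q) (q₁ q₂ : Q), n.Nonempty → q₁ ∉ n → q₂ ∉ insert q₁ n →
        (∃ m, ¬ TQ q₂ (κ m (insert q₂ (insert q₁ n)))) → ∃ m, κ m n ≠ 0) ∧
      (∀ n : Finset Q, n.Nonempty → finrank F (Sel ∅ n true) + finrank F (Sel ∅ n false) = 1 → κ ∅ n ≠ 0) ∧
      (∀ (n : Finset Q) (m : Finset M), finrank F (Sel m n true) + finrank F (Sel m n false) ≠ 1 → κ m n = 0) := by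
  obtain ⟨ε₀, κ, hmem, hrel, hne, hzero⟩ :=
    exists_canonicalUpperLevels_core Sel TM hfin hTM0 hTMsmul hDrop hRise hJump
  refine ⟨ε₀, κ, hmem, hrel, ?_, fun n _ h1 ↦ hne n ∅ h1, hzero⟩
  intro n q₁ q₂ hn hq₁ hq₂ hdet
  obtain ⟨m, hm⟩ := hdet
  -- the conductor-direction parity transfer at a non-empty level
  have hparm : ∀ (N : Finset Q) (m : Finset M), N.Nonempty →
      (Even (finrank F (Sel m N true) + finrank F (Sel m N false)) ↔
        Even (finrank F (Sel ∅ N true) + finrank F (Sel ∅ N false))) := fun N m hN ↦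
    even_total_iff Sel TM N (fun m ℓ μ hℓ ↦ hDrop m ℓ N μ hℓ hN) (fun m ℓ μ hℓ ↦ hRise m ℓ N μ hℓ hN)
      (fun m ℓ μ hℓ ↦ hJump m ℓ N μ hℓ hN) m
  -- two primes up there is a core, so that level — hence `n` — is even
  have hN₂ne : (insert q₂ (insert q₁ n)).Nonempty := Finset.insert_nonempty q₂ _
  have htop1 : finrank F (Sel m (insert q₂ (insert q₁ n)) true) + finrank F (Sel m (insert q₂ (insert q₁ n)) false) = 1 := by
    by_contra h
    exact hm ((hzero _ m h).symm ▸ hTQ0 q₂)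
  have hcard : (insert q₂ (insert q₁ n)).card = n.card + 2 := by
    rw [Finset.card_insert_of_notMem hq₂, Finset.card_insert_of_notMem hq₁]
  have heven : Even n.card := by
    have h2 : Even (insert q₂ (insert q₁ n)).card := by
      rw [← hpar _ hN₂ne, ← Nat.not_even_iff_odd, ← hparm _ m hN₂ne, htop1]
      simp
    rw [hcard, Nat.even_add] at h2
    exact h2.mpr (by decide)
  -- so `Sel(∅, n)` has odd total rank and a core conductor lies above `∅`
  have hodd : Odd (finrank F (Sel ∅ n true) + finrank F (Sel ∅ n false)) := (hpar n hn).mpr heven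
  obtain ⟨m', -, hm'⟩ := exists_core_conductor_superset Sel TM n hn hfin hTM0 hDrop hRise hJump hCheb1 hCheb2 ∅ hodd
  exact ⟨m', hne n m' hm'⟩

end Summit.BirchSwinnertonDyer.Rank1Residual.X11b.Three.Koly.CoreGraph

end
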